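import Summits.BirchSwinnertonDyer.BirchSwinnertonDyer.Theorems.ResidualThetaTransportAtTwoSignedMuSeedAtTwoPlusSmoothingCoboundaryOrbit
import HarnessLib

/-!
# Smoothing coboundary X — the Frobenius law of an orbit functional from pointwise Frobenius transport
# (card (C) of `Ideas/smoothing-coboundary.md`: «applying the absolute Frobenius σ … σQ̃ = g·ι(λ′)Q̃ … gives
# `f(α)² = g̃⁻¹χ₀(λ′)^e·f(ᾱ)`», the hypothesis `hfrob` of `…Orbit.frobeniusBit`)
# (seed crux `SignedMuSeedAtTwoPlus` stmt-BirchSwinnertonDyer-21438; parent Kμ⁺ stmt-BirchSwinnertonDyer-20689, route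
# ResidualThetaTransportAtTwo; line card `Cruxes/SignedMuSeedAtTwoPlus/Lines/smoothing-coboundary.md`, stub CS4 `FrobeniusBit`)

Cell `bsd-wall`, width seat `bsd-wall-rtt-p4-w2` g15 (`--supports`, closes nothing).  THEOREMS ONLY; BSD is not proved by this.

In characteristic `2` squaring is additive, so for an orbit functional `f = Σ_c χ(c)·g(c)` over a finite orbit group with a
cube-root-of-unity valued character `χ`:  if the orbit values transport under Frobenius as `g(c)² = γ·h(π c)` along a
permutation `π` of the orbit with `χ(π c) = λ·χ(c)²` (geometrically: `π(c) = c̄·λ′`, `χ₀(c̄) = χ₀(c)⁻¹ = χ₀(c)²`,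
`λ = χ₀(λ′)`, `γ = g̃⁻¹`, `h` = the orbit values of `ᾱ`), then

* **`sq_orbitSum_eq`** — `(Σ_c χ c·g c)² = γ·λ²·Σ_c χ c·h c`: the Frobenius law `f(α)² = ε·f(ᾱ)` with `ε = γλ²`
  (`= g̃⁻¹χ₀(λ′)⁻¹`; the card's exponent conventions differ by the twist sign), i.e. the input `hfrob` of `frobeniusBit`;
* `sq_sum_charTwo` — `(Σ a_c)² = Σ a_c²`; `sq_eq_mul_of_cube` — `χ(π c) = λ·χ(c)² ⟹ χ(c)² = λ²·χ(π c)` for cube roots of unity.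

[folklore]
-/

set_option autoImplicit false
-- the Theorems namespace of this sub repeats the summit name by design (D-0017 nested layout)
set_option linter.dupNamespace false

open Finset

namespace Summit.BirchSwinnertonDyer.BirchSwinnertonDyer.Theorems.SignedMuAtTwo.SmoothingCoboundary

variable {R : Type*} [CommRing R] [CharP R 2]

/-- In characteristic `2`, `(Σ_c a_c)² = Σ_c a_c²` (the Frobenius is additive). [folklore] -/
theorem sq_sum_charTwo {ι : Type*} (s : Finset ι) (a : ι → R) : (∑ i ∈ s, a i) ^ 2 = ∑ i ∈ s, a i ^ 2 := by
  have h := map_sum (frobenius R 2) a s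
  simpa only [frobenius_def] using h

omit [CharP R 2] in
/-- Cube-root-of-unity bookkeeping: `λ³ = 1`, `χ(π c) = λ·χ(c)²`, `χ(c)³ = 1 ⟹ χ(c)² = λ²·χ(π c)`. [folklore] -/
theorem sq_eq_mul_of_cube {x y lam : R} (hlam : lam ^ 3 = 1) (hx : x ^ 3 = 1) (h : y = lam * x ^ 2) :
    x ^ 2 = lam ^ 2 * y := by
  rw [h]
  linear_combination (-(x ^ 2)) * hlam + 0 * hx

variable {G : Type*} [CommGroup G] [Fintype G] (χ : G →* R)

/-- **Frobenius law of an orbit functional** (card (C), input of `frobeniusBit`): if `χ` is cube-root-of-unity valued,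
`π` is a permutation of the orbit with `χ(π c) = λ·χ(c)²` (`λ³ = 1`), and the orbit values transport as `g(c)² = γ·h(π c)`,
then `(Σ_c χ c·g c)² = γ·λ²·Σ_c χ c·h c`. [folklore] -/
theorem sq_orbitSum_eq (hχ : ∀ c, χ c ^ 3 = 1) (π : Equiv.Perm G) {lam γ : R} (hlam : lam ^ 3 = 1)
    (hπ : ∀ c, χ (π c) = lam * χ c ^ 2) (g h : G → R) (hfrob : ∀ c, g c ^ 2 = γ * h (π c)) :
    (∑ c, χ c * g c) ^ 2 = γ * lam ^ 2 * ∑ c, χ c * h c := by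
  rw [sq_sum_charTwo, mul_sum]
  -- termwise: (χ c g c)² = γ λ² χ(π c) h(π c), then re-index along π
  have hterm : ∀ c, (χ c * g c) ^ 2 = γ * lam ^ 2 * (χ (π c) * h (π c)) := by
    intro c
    rw [mul_pow, hfrob c, sq_eq_mul_of_cube hlam (hχ c) (hπ c)]
    ring
  simp_rw [hterm]
  exact Equiv.sum_comp π (fun c => γ * lam ^ 2 * (χ c * h c))

/-- The same read as the hypothesis shape of `frobeniusBit`: with `ε := γ·λ²`, `f(α)² = ε·f(ᾱ)` where `f(α) = Σ χ·g` and
`f(ᾱ) = Σ χ·h`. [folklore] -/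
theorem orbitSum_frobenius_law (hχ : ∀ c, χ c ^ 3 = 1) (π : Equiv.Perm G) {lam γ : R} (hlam : lam ^ 3 = 1)
    (hπ : ∀ c, χ (π c) = lam * χ c ^ 2) (g h : G → R) (hfrob : ∀ c, g c ^ 2 = γ * h (π c)) :
    ∃ ε : R, (∑ c, χ c * g c) ^ 2 = ε * ∑ c, χ c * h c :=
  ⟨γ * lam ^ 2, sq_orbitSum_eq χ hχ π hlam hπ g h hfrob⟩

end Summit.BirchSwinnertonDyer.BirchSwinnertonDyer.Theorems.SignedMuAtTwo.SmoothingCoboundary
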